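import Mathlib
import HarnessLib

/-!
# Routing odds of multi-neck structures: the tomography identity and its stability (stub S4, brick B3)

Crux `Summit.CriticalPhenomena.CardyFormulaZ2.Theses.CardyMagicRigidity.NestingRigidity`
(stmt-CriticalPhenomena-4835), line `pinch-resampling` v2, registered stub `stub_tomographicTransfer`
(`FourArmCouplingT → FourArmCouplingZ2 → LoopLimitZ2Blind → LoopLimitZ2EqT`).  Part (ii) of its mechanism ("neck
tomography") reads the ROUTING of a macroscopic multi-neck structure — which of the admissible joint states of its
necks is realised — as a ratio of products of single-neck probabilities: if neck `i` is open with probability `h i`,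
independently over the necks given everything outside the neck regions, and the blind-visible data restrict the joint
state `b : ι → Bool` to an admissible set `A`, then

  `P(b | A) = w_h(b) / Σ_{b' ∈ A} w_h(b')`,  `w_h(b) = ∏_i (h i if b i, else 1 - h i)`      (`routingLaw`)

(two-mouth lake: `π = h₁(1-h₂) / (h₁(1-h₂) + (1-h₁)h₂)`, `routingLaw_lake`; interleaved pair:
`(1-h₁)(1-h₂) : h₁h₂`, `routingLaw_interleaved`).  This file is the finite real algebra of that identity and the
quantitative statement the identification step (iii) consumes:

* `neckWeight`, `oddsWeight`, `routingLaw`, `openCount` and their elementary API (`neckWeight_eq_mul_oddsWeight`: after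
  dividing by `∏ (1 - h i)` the weight of `b` is the product of the ODDS `h i / (1 - h i)` over the OPEN necks of `b`
  only; `routingLaw_eq_oddsWeight_div`);
* **stability in the odds, uniformly in the number of necks** (`routingLaw_le_pow_mul_routingLaw`, the registered
  anchor, and `sum_abs_routingLaw_sub_le`): if the single-neck odds of `h` and `h'` agree up to a factor `K ≥ 1` and
  every admissible state has at most `k` open necks, the two routing laws agree up to the factor `K^{2k}` pointwise,
  hence `Σ_{b ∈ A} |π_h(b) - π_{h'}(b)| ≤ 2 (K^{2k} - 1)` — the error is governed by the number of OPEN necks of the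
  admissible states (a spanning-forest count, bounded by the number of macroscopic pieces), not by the total number of
  necks of the structure;
* `odds_le_sq_mul_odds_of_abs_sub_le`: on `{δ₀ ≤ h ≤ 1 - δ₀}` an additive error `|h - h'| ≤ e` is a multiplicative
  error `K = (1 + e/δ₀)²` on the odds (the Lipschitz form).

Pure real analysis; no percolation object is mentioned.
-/

noncomputable section

namespace Summit.CriticalPhenomena.CardyFormulaZ2.Cruxes.NestingRigidity.PinchResampling

open Finset
open scoped BigOperators

section Routing

variable {ι : Type*} [Fintype ι]

/-- The product weight of a joint neck state `b` under independent necks with opening probabilities `h`: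
`w_h(b) = ∏_i (h i if b i else 1 - h i)`. -/
def neckWeight (h : ι → ℝ) (b : ι → Bool) : ℝ := ∏ i, if b i then h i else 1 - h i

/-- The odds weight of a joint neck state: the product of the odds `h i / (1 - h i)` over the OPEN necks of `b`. -/
def oddsWeight (h : ι → ℝ) (b : ι → Bool) : ℝ := ∏ i, if b i then h i / (1 - h i) else 1

/-- The number of open necks of a joint state. -/
def openCount (b : ι → Bool) : ℕ := (univ.filter fun i ↦ b i = true).card

/-- **The routing law**: the conditional probability of the joint state `b` given that the state lies in the
admissible set `A`, for independent necks with opening probabilities `h` (junk value `0` off `A` is NOT imposed: the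
formula is the ratio `w_h(b) / Σ_{b' ∈ A} w_h(b')`, and `0` when the denominator vanishes). -/
def routingLaw (h : ι → ℝ) (A : Finset (ι → Bool)) (b : ι → Bool) : ℝ :=
  neckWeight h b / ∑ b' ∈ A, neckWeight h b'

/-- Weights are nonnegative for `0 ≤ h ≤ 1`. -/
theorem neckWeight_nonneg {h : ι → ℝ} (hh : ∀ i, 0 ≤ h i ∧ h i ≤ 1) (b : ι → Bool) : 0 ≤ neckWeight h b := by
  unfold neckWeight
  refine prod_nonneg fun i _ ↦ ?_
  split_ifs
  · exact (hh i).1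
  · linarith [(hh i).2]

/-- Odds weights are nonnegative for `0 ≤ h < 1`. -/
theorem oddsWeight_nonneg {h : ι → ℝ} (hh : ∀ i, 0 ≤ h i ∧ h i < 1) (b : ι → Bool) : 0 ≤ oddsWeight h b := by
  unfold oddsWeight
  refine prod_nonneg fun i _ ↦ ?_
  split_ifs
  · exact div_nonneg (hh i).1 (by linarith [(hh i).2])
  · exact zero_le_one

/-- The routing law is nonnegative for `0 ≤ h ≤ 1`. -/
theorem routingLaw_nonneg {h : ι → ℝ} (hh : ∀ i, 0 ≤ h i ∧ h i ≤ 1) (A : Finset (ι → Bool)) (b : ι → Bool) :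
    0 ≤ routingLaw h A b :=
  div_nonneg (neckWeight_nonneg hh b) (sum_nonneg fun b' _ ↦ neckWeight_nonneg hh b')

/-- The routing law has total mass `≤ 1` on the admissible set (exactly `1` unless all admissible weights vanish). -/
theorem sum_routingLaw_le_one (h : ι → ℝ) (A : Finset (ι → Bool)) : ∑ b ∈ A, routingLaw h A b ≤ 1 := by
  unfold routingLaw
  rw [← sum_div]
  exact div_self_le_one _

/-- The routing law has total mass exactly `1` on the admissible set when some admissible weight is positive and all
are nonnegative. -/
theorem sum_routingLaw_eq_one {h : ι → ℝ} (hh : ∀ i, 0 ≤ h i ∧ h i ≤ 1) {A : Finset (ι → Bool)}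
    (hA : ∃ b ∈ A, 0 < neckWeight h b) : ∑ b ∈ A, routingLaw h A b = 1 := by
  unfold routingLaw
  rw [← sum_div]
  refine div_self (ne_of_gt ?_)
  obtain ⟨b, hb, hpos⟩ := hA
  exact lt_of_lt_of_le hpos (single_le_sum (fun b' _ ↦ neckWeight_nonneg hh b') hb)

/-- **Odds form of the weight**: `w_h(b) = (∏_i (1 - h i)) · ∏_{i open} h i / (1 - h i)` (for `h < 1`). -/
theorem neckWeight_eq_mul_oddsWeight {h : ι → ℝ} (hh : ∀ i, h i < 1) (b : ι → Bool) :
    neckWeight h b = (∏ i, (1 - h i)) * oddsWeight h b := by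
  unfold neckWeight oddsWeight
  rw [← prod_mul_distrib]
  refine prod_congr rfl fun i _ ↦ ?_
  have hne : 1 - h i ≠ 0 := by linarith [hh i]
  split_ifs
  · field_simp
  · ring

/-- **Odds form of the routing law**: the common factor `∏ (1 - h i)` cancels, so the routing law is the normalised odds
weight — it depends on the necks only through the odds of the OPEN necks of the admissible states. -/
theorem routingLaw_eq_oddsWeight_div {h : ι → ℝ} (hh : ∀ i, h i < 1) (A : Finset (ι → Bool)) (b : ι → Bool) :
    routingLaw h A b = oddsWeight h b / ∑ b' ∈ A, oddsWeight h b' := by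
  unfold routingLaw
  have hc : (∏ i, (1 - h i)) ≠ 0 := prod_ne_zero_iff.2 fun i _ ↦ by linarith [hh i]
  simp_rw [neckWeight_eq_mul_oddsWeight hh, ← mul_sum]
  exact mul_div_mul_left _ _ hc

/-- The odds weight as a product over the open necks only. -/
theorem oddsWeight_eq_prod_filter (h : ι → ℝ) (b : ι → Bool) :
    oddsWeight h b = ∏ i ∈ univ.filter (fun i ↦ b i = true), h i / (1 - h i) := by
  unfold oddsWeight
  rw [prod_filter]

/-- **One-sided stability of the odds weight**: if every single-neck odds of `h'` is at most `K` times that of `h`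
(`K ≥ 1`) and `b` has at most `k` open necks, then `oddsWeight h' b ≤ K^k · oddsWeight h b`. -/
theorem oddsWeight_le_pow_mul {K : ℝ} {k : ℕ} {h h' : ι → ℝ} (hK : 1 ≤ K) (hh : ∀ i, 0 ≤ h i ∧ h i < 1)
    (hh' : ∀ i, 0 ≤ h' i ∧ h' i < 1) (hup : ∀ i, h' i / (1 - h' i) ≤ K * (h i / (1 - h i))) {b : ι → Bool}
    (hb : openCount b ≤ k) : oddsWeight h' b ≤ K ^ k * oddsWeight h b := by
  rw [oddsWeight_eq_prod_filter, oddsWeight_eq_prod_filter]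
  set s := univ.filter (fun i ↦ b i = true) with hs
  have hodds : ∀ i, 0 ≤ h i / (1 - h i) := fun i ↦ div_nonneg (hh i).1 (by linarith [(hh i).2])
  have hodds' : ∀ i, 0 ≤ h' i / (1 - h' i) := fun i ↦ div_nonneg (hh' i).1 (by linarith [(hh' i).2])
  calc ∏ i ∈ s, h' i / (1 - h' i) ≤ ∏ i ∈ s, K * (h i / (1 - h i)) :=
        prod_le_prod (fun i _ ↦ hodds' i) fun i _ ↦ hup i
    _ = K ^ s.card * ∏ i ∈ s, h i / (1 - h i) := by rw [prod_mul_distrib, prod_const]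
    _ ≤ K ^ k * ∏ i ∈ s, h i / (1 - h i) :=
        mul_le_mul_of_nonneg_right (pow_le_pow_right₀ hK hb) (prod_nonneg fun i _ ↦ hodds i)

/-- **Stability of the routing law in the single-neck odds, uniformly in the number of necks** (registered anchor of
this file).  If the single-neck odds `h i/(1 - h i)` and `h' i/(1 - h' i)` agree up to a factor `K ≥ 1` in both
directions and every admissible state has at most `k` open necks, then `π_{h'}(b) ≤ K^{2k} π_h(b)` for every admissible
`b`: one factor `K^k` from the numerator, one from the denominator.  The total number of necks does not enter. -/
theorem routingLaw_le_pow_mul_routingLaw : ∀ {ι : Type*} [Fintype ι] (K : ℝ) (k : ℕ) (h h' : ι → ℝ) (A : Finset (ι → Bool)) (b : ι → Bool), 1 ≤ K → (∀ i, 0 ≤ h i ∧ h i < 1) → (∀ i, 0 ≤ h' i ∧ h' i < 1) → (∀ i, h' i / (1 - h' i) ≤ K * (h i / (1 - h i))) → (∀ i, h i / (1 - h i) ≤ K * (h' i / (1 - h' i))) → (∀ b' ∈ A, openCount b' ≤ k) → b ∈ A → routingLaw h' A b ≤ K ^ (2 * k) * routingLaw h A b := by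
  intro ι _ K k h h' A b hK hh hh' hup hdown hA hb
  have h1 : ∀ i, h i < 1 := fun i ↦ (hh i).2
  have h1' : ∀ i, h' i < 1 := fun i ↦ (hh' i).2
  rw [routingLaw_eq_oddsWeight_div h1', routingLaw_eq_oddsWeight_div h1]
  set S := ∑ b' ∈ A, oddsWeight h b' with hS
  set S' := ∑ b' ∈ A, oddsWeight h' b' with hS'
  have hKk : 0 ≤ K ^ k := pow_nonneg (zero_le_one.trans hK) k
  have hnum : oddsWeight h' b ≤ K ^ k * oddsWeight h b := oddsWeight_le_pow_mul hK hh hh' hup (hA b hb)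
  have hden : S ≤ K ^ k * S' := by
    rw [hS, hS', mul_sum]
    exact sum_le_sum fun b' hb' ↦ oddsWeight_le_pow_mul hK hh' hh hdown (hA b' hb')
  have hS0 : 0 ≤ S := sum_nonneg fun b' _ ↦ oddsWeight_nonneg hh b'
  have hS'0 : 0 ≤ S' := sum_nonneg fun b' _ ↦ oddsWeight_nonneg hh' b'
  have hob : 0 ≤ oddsWeight h b := oddsWeight_nonneg hh b
  have hpow : K ^ (2 * k) = K ^ k * K ^ k := by rw [two_mul, pow_add]
  rcases eq_or_lt_of_le hS'0 with hS'z | hS'pos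
  · -- all admissible `h'`-weights vanish: the left-hand side is the junk value `0`
    rw [← hS'z, div_zero]
    exact mul_nonneg (pow_nonneg (zero_le_one.trans hK) _) (div_nonneg hob hS0)
  rcases eq_or_lt_of_le hS0 with hSz | hSpos
  · -- all admissible `h`-weights vanish: then so does the weight of `b ∈ A`, and the bound on the numerator gives `0`
    have hob0 : oddsWeight h b = 0 :=
      le_antisymm (hSz ▸ single_le_sum (fun b' _ ↦ oddsWeight_nonneg hh b') hb) hob
    have hnum0 : oddsWeight h' b = 0 :=
      le_antisymm (by simpa [hob0] using hnum) (oddsWeight_nonneg hh' b)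
    rw [hnum0, hob0, zero_div, zero_div, mul_zero]
  calc oddsWeight h' b / S' ≤ K ^ k * oddsWeight h b / S' := div_le_div_of_nonneg_right hnum hS'0
    _ ≤ K ^ k * oddsWeight h b / (S / K ^ k) := by
        refine div_le_div_of_nonneg_left (mul_nonneg hKk hob) (div_pos hSpos (by positivity)) ?_
        rw [div_le_iff₀ (by positivity)]
        linarith [hden, mul_comm (K ^ k) S']
    _ = K ^ (2 * k) * (oddsWeight h b / S) := by
        rw [hpow]
        field_simp

/-- **Total-variation form**: under the two-sided odds comparison of `routingLaw_le_pow_mul_routingLaw`,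
`Σ_{b ∈ A} |π_h(b) - π_{h'}(b)| ≤ 2 (K^{2k} - 1)`. -/
theorem sum_abs_routingLaw_sub_le {K : ℝ} {k : ℕ} {h h' : ι → ℝ} {A : Finset (ι → Bool)} (hK : 1 ≤ K)
    (hh : ∀ i, 0 ≤ h i ∧ h i < 1) (hh' : ∀ i, 0 ≤ h' i ∧ h' i < 1)
    (hup : ∀ i, h' i / (1 - h' i) ≤ K * (h i / (1 - h i)))
    (hdown : ∀ i, h i / (1 - h i) ≤ K * (h' i / (1 - h' i))) (hA : ∀ b' ∈ A, openCount b' ≤ k) :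
    ∑ b ∈ A, |routingLaw h A b - routingLaw h' A b| ≤ 2 * (K ^ (2 * k) - 1) := by
  have hle1 : ∀ i, 0 ≤ h i ∧ h i ≤ 1 := fun i ↦ ⟨(hh i).1, (hh i).2.le⟩
  have hle1' : ∀ i, 0 ≤ h' i ∧ h' i ≤ 1 := fun i ↦ ⟨(hh' i).1, (hh' i).2.le⟩
  have hK2 : 1 ≤ K ^ (2 * k) := one_le_pow₀ hK
  have hterm : ∀ b ∈ A, |routingLaw h A b - routingLaw h' A b| ≤
      (K ^ (2 * k) - 1) * (routingLaw h A b + routingLaw h' A b) := by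
    intro b hb
    have h₁ := routingLaw_le_pow_mul_routingLaw K k h h' A b hK hh hh' hup hdown hA hb
    have h₂ := routingLaw_le_pow_mul_routingLaw K k h' h A b hK hh' hh hdown hup hA hb
    have hp := routingLaw_nonneg hle1 A b
    have hp' := routingLaw_nonneg hle1' A b
    rw [abs_le]
    constructor <;> nlinarith
  calc ∑ b ∈ A, |routingLaw h A b - routingLaw h' A b|
      ≤ ∑ b ∈ A, (K ^ (2 * k) - 1) * (routingLaw h A b + routingLaw h' A b) := sum_le_sum hterm
    _ = (K ^ (2 * k) - 1) * (∑ b ∈ A, routingLaw h A b + ∑ b ∈ A, routingLaw h' A b) := by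
        rw [← mul_sum, sum_add_distrib]
    _ ≤ (K ^ (2 * k) - 1) * (1 + 1) := by
        refine mul_le_mul_of_nonneg_left ?_ (by linarith)
        exact add_le_add (sum_routingLaw_le_one h A) (sum_routingLaw_le_one h' A)
    _ = 2 * (K ^ (2 * k) - 1) := by ring

/-- **Additive errors are multiplicative on the odds away from `0` and `1`** (the Lipschitz form): if
`δ₀ ≤ h, h' ≤ 1 - δ₀` with `δ₀ > 0` and `|h - h'| ≤ e`, then `h'/(1-h') ≤ (1 + e/δ₀)² · h/(1-h)`. -/
theorem odds_le_sq_mul_odds_of_abs_sub_le {δ₀ e x y : ℝ} (hδ : 0 < δ₀) (he : 0 ≤ e) (hx : δ₀ ≤ x ∧ x ≤ 1 - δ₀)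
    (hy : δ₀ ≤ y ∧ y ≤ 1 - δ₀) (hxy : |x - y| ≤ e) :
    y / (1 - y) ≤ (1 + e / δ₀) ^ 2 * (x / (1 - x)) := by
  have hxy' := abs_le.1 hxy
  have h1x : 0 < 1 - x := by linarith
  have h1y : 0 < 1 - y := by linarith
  have hK : 0 ≤ 1 + e / δ₀ := by positivity
  -- numerator: `y ≤ x + e ≤ x (1 + e/δ₀)` because `e ≤ x e / δ₀`
  have hnum : y ≤ (1 + e / δ₀) * x := by
    have : e ≤ x * (e / δ₀) := by
      rw [mul_div_assoc']
      rw [le_div_iff₀ hδ]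
      nlinarith
    nlinarith
  -- denominator: `1 - x ≤ (1 - y) + e ≤ (1 - y)(1 + e/δ₀)` because `e ≤ (1 - y) e / δ₀`
  have hden : 1 - x ≤ (1 + e / δ₀) * (1 - y) := by
    have : e ≤ (1 - y) * (e / δ₀) := by
      rw [mul_div_assoc']
      rw [le_div_iff₀ hδ]
      nlinarith
    nlinarith
  rw [div_le_iff₀ h1y]
  have hxpos : 0 ≤ x := le_trans hδ.le hx.1
  calc y ≤ (1 + e / δ₀) * x := hnum
    _ = (1 + e / δ₀) * (x / (1 - x)) * (1 - x) := by field_simp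
    _ ≤ (1 + e / δ₀) * (x / (1 - x)) * ((1 + e / δ₀) * (1 - y)) :=
        mul_le_mul_of_nonneg_left hden (mul_nonneg hK (div_nonneg hxpos h1x.le))
    _ = (1 + e / δ₀) ^ 2 * (x / (1 - x)) * (1 - y) := by ring

end Routing

/-! ## The two two-neck examples of the line card -/

/-- The admissible set of the TWO-MOUTH LAKE: exactly one of the two necks is open. -/
def lakeStates : Finset (Fin 2 → Bool) := {![true, false], ![false, true]}

/-- The admissible set of the INTERLEAVED PAIR: both necks closed or both open. -/
def interleavedStates : Finset (Fin 2 → Bool) := {![false, false], ![true, true]}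

/-- The two lake states differ. -/
theorem lake_ne : (![true, false] : Fin 2 → Bool) ≠ ![false, true] :=
  fun h ↦ by simpa using congrFun h 0

/-- The two interleaved states differ. -/
theorem interleaved_ne : (![false, false] : Fin 2 → Bool) ≠ ![true, true] :=
  fun h ↦ by simpa using congrFun h 0

/-- **The tomography identity for the two-mouth lake** (line card, item 3): conditionally on "exactly one of the two
necks is open", neck `0` is the open one with probability `h₀(1-h₁) / (h₀(1-h₁) + (1-h₀)h₁)`. -/
theorem routingLaw_lake (h : Fin 2 → ℝ) :
    routingLaw h lakeStates ![true, false] = h 0 * (1 - h 1) / (h 0 * (1 - h 1) + (1 - h 0) * h 1) := by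
  unfold routingLaw lakeStates neckWeight
  rw [sum_pair lake_ne]
  simp [Fin.prod_univ_two]

/-- **The routing odds of the interleaved pair** (line card, item 3): conditionally on "both closed or both open",
both necks are closed with probability `(1-h₀)(1-h₁) / ((1-h₀)(1-h₁) + h₀h₁)`. -/
theorem routingLaw_interleaved (h : Fin 2 → ℝ) :
    routingLaw h interleavedStates ![false, false] =
      (1 - h 0) * (1 - h 1) / ((1 - h 0) * (1 - h 1) + h 0 * h 1) := by
  unfold routingLaw interleavedStates neckWeight
  rw [sum_pair interleaved_ne]
  simp [Fin.prod_univ_two]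

/-- Every lake state has exactly one open neck (so `k = 1` in `routingLaw_le_pow_mul_routingLaw`: the lake routing
odds move by at most the factor `K²` when the single-neck odds move by the factor `K`). -/
theorem openCount_le_one_of_mem_lakeStates : ∀ b ∈ lakeStates, openCount b ≤ 1 := by
  intro b hb
  simp only [lakeStates, mem_insert, mem_singleton] at hb
  rcases hb with rfl | rfl <;> decide

end Summit.CriticalPhenomena.CardyFormulaZ2.Cruxes.NestingRigidity.PinchResampling

end
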